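import Summits.Ventures.AbcSig.Rows.XTemplateHalves
import Summits.Ventures.AbcSig.Levels.N4384

/-!
# Venture AbcSig — PARITY-HALF ROW `C2aL137A3yoddAB`: `137^m·xⁿ + 8·yⁿ = z²`, `y` odd (class `a = 3`, second distribution) over the NORM-FORM level file 4384 = 32·137 (GENERATED by p-lean g4 `gen4/halfrow.py`)

HONEST FRAMING. A row of a COMPUTATION cell (`pub-abcsig`); a CONDITIONAL theorem, no claim on ABC or any summit.
Hypotheses: `BS04Package` (CITED: [BS04] Lemma 3.3 + (3.1) + Lemma 4.2); `DataComplete 4384` + `RefinesCPSymAll 4384` (COMPUTED: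
certified engine-1 level file; norm-form certificates `Sieve/CharpolyCert.lean`, prime-ideal trees where the norm form is weaker);
the listed per-orbit exclusions `hX_…` (CITED: the row of record's module closures — nothing of them is checked here).
Only the parity half living at the single level 32·137 is claimed (the complementary half needs level 2·137, not certified).
Exponent range: prime `n ≥ 11`, `n ≠ 137`; `1 ≤ m < n`.
Residual of record: none. CITED per the row of record's R3: 4384.8 @ 13: M4; 4384.9 @ 13: M4; 4384.11 @ 29: M4/M6c-old.
Row of record: `census/rows/C2a/C2a-l137-a3-yodd.md` (sha16 `e40d2ad1c77bc17f`; SIGNED 2026-08-22T16:05:08Z by referee (ref-g11)).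
-/

namespace Summit.Ventures.AbcSig

/-- Parity-half row `C2aL137A3yoddAB` (`137^m·xⁿ + 8·yⁿ = z²`, `y` odd (class `a = 3`, second distribution)); prime `n ≥ 11`, `n ≠ 137`; conditional on the named hypotheses. -/
theorem xrow_C2aL137A3yoddAB (M : NewformModel) (hP : M.BS04Package)
    (hD4384 : M.DataComplete 4384 level4384Orbits) (hCP4384 : M.RefinesCPSymAll 4384 level4384CP)
    (n : ℕ) (hn : n.Prime) (hmin : 11 ≤ n) (hnℓ : n ≠ 137) (m : ℕ) (hm : 1 ≤ m) (hmn : m < n)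
    (hX_orbit_4384_8 : n ∈ ([13] : List ℕ) → M.Excludes 4384 orbit_4384_8
      (famAB (137 ^ m) (2 ^ 3) n (fun _ _ => True)))
    (hX_orbit_4384_9 : n ∈ ([13] : List ℕ) → M.Excludes 4384 orbit_4384_9
      (famAB (137 ^ m) (2 ^ 3) n (fun _ _ => True)))
    (hX_orbit_4384_11 : n ∈ ([29] : List ℕ) → M.Excludes 4384 orbit_4384_11
      (famAB (137 ^ m) (2 ^ 3) n (fun _ _ => True)))
    (x y z : ℤ) (hy : ¬ 2 ∣ y) (hxy1 : x * y ≠ 1) (hxy2 : x * y ≠ -1) : ¬ IsPrimitiveSolution (137 ^ m) (2 ^ 3) 1 n x y z := by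
  have hℓ : Nat.Prime 137 := by norm_num
  have h7 : 7 ≤ n := by omega
  exact xrowC2aAB_a3_yodd 137 hℓ (by norm_num) M hP n hn h7 hnℓ hD4384 m hm hmn
    (level4384_sieve M hP hCP4384 n hn h7 (fun o => M.Excludes 4384 o
      (famAB (137 ^ m) (2 ^ 3) n (fun _ _ => True)) ∨ M.ExcludesStd 4384 o n) (fun _ h => Or.inr h) (fun hmem => by
      obtain rfl : n = 7 := by simpa using hmem
      omega) (fun hmem => by
      obtain rfl : n = 7 := by simpa using hmem
      omega) (fun hmem => by
      obtain rfl : n = 7 := by simpa using hmem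
      omega) (fun hmem => by
      obtain rfl : n = 7 := by simpa using hmem
      omega) (fun hmem => by
      obtain rfl : n = 7 := by simpa using hmem
      omega) (fun hmem => by
      rcases (by simpa using hmem : n = 7 ∨ n = 13) with rfl | rfl
      · omega
      · exact Or.inl (hX_orbit_4384_8 (by simp))) (fun hmem => by
      rcases (by simpa using hmem : n = 7 ∨ n = 13) with rfl | rfl
      · omega
      · exact Or.inl (hX_orbit_4384_9 (by simp))) (fun hmem => by
      rcases (by simpa using hmem : n = 7 ∨ n = 29) with rfl | rfl
      · omega
      · exact Or.inl (hX_orbit_4384_11 (by simp))))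
    x y z hy hxy1 hxy2

end Summit.Ventures.AbcSig
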